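import Summits.AnomalousDissipation.AnomalousDissipation.Theorems.UniformResolution.Negative.Shape
import Summits.AnomalousDissipation.AnomalousDissipation.Theorems.UniformResolution.Negative.ShearLaw
import Summits.AnomalousDissipation.AnomalousDissipation.Theorems.UniformResolution.Negative.FGTBound
import Summits.AnomalousDissipation.AnomalousDissipation.Theorems.QuarticGate.Negative.Laminar
import Summits.AnomalousDissipation.AnomalousDissipation.Theorems.MomentLadder.Negative.LoadBearing

/-!
# Negative knowledge for the crux `UniformResolution` (stmt-AnomalousDissipation-14330), IX:
# the LOAD-BEARING TABLE, the fixed-viscosity laminar instance, the steady sector and the criterion applied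

Certified from the standing disprover's work file `Cruxes/UniformResolution/Disproof.lean` (sections D, E, H, F, G of
refuter-cdisprove-stmt-AnomalousDissipation-14330-0, cycle 1, rev 6; landed by the generation-2 seat
refuter-cdisprove-stmt-AnomalousDissipation-14330-g2-0, which found them sorry-free but never proposed).
Supports stmt-AnomalousDissipation-14330 (route decls `QuarticLadder.UniformResolution` ≡ `MomentParity.UniformResolution`,
definitionally equal bodies); NO route-item statement is asserted positively: every theorem below either NEGATES a
weakening of the crux (`not_uniformResolution…` = "any proof must use that hypothesis"), or records that a weakening is
EQUIVALENT to the crux, or proves the conclusion body on a special sector (laminar / steady Diracs, which are not route items).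

* §D LOAD-BEARING TABLE. `not_uniformResolutionMeanRowOnly` — the antecedent's stationarity must be used on observables
  of degree ≥ 2 (with the mean-flow row only, the symmetric shear laws at the cutoff shell are loud at ZERO force);
  `not_uniformResolutionWithoutStationarity`; `not_uniformResolutionWithoutEpsPos` (`δ₀` at `f = 0`);
  `uniformResolutionWithoutNuPos_iff` (`∀ j, 0 < ν j` is REDUNDANT).
* §E FIXED VISCOSITY. `isResolvedLoudFamilyAt_laminar`: at each fixed `ν` the conclusion body is satisfiable (laminar
  Kolmogorov Diracs, `κ ≡ 1`, budgets `E'_ν = (4π²ν)⁻²/2 → ∞`): the content of the crux is the `j`-UNIFORM budget pair;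
  `laminar_instance_constant_viscosity` (the weakening without `ν_j → 0` is not refuted by laminar states).
* §H CRITERION APPLIED. `isResolvedLoudFamilyAt_of_criterion`, `isResolvedLoudFamilyAt_of_fgt_of_uniformlyIntegrable`:
  the conclusion body at `ν` follows from FGT-stationary loud invariant level laws in a ball PLUS uniform integrability of
  the enstrophy over the family (the open core; cf. the live line's `stub_loudUI`).
* §F STEADY SECTOR. `isResolvedLoudFamilyAt_of_steady`: a loud family of Galerkin STEADY states in a ball is a resolved loud
  family (N-uniform `H²` bound of `Negative/SteadyResolved.lean`); hence `not_isLoudSteadyFamilyAt_of_not_uniformResolution`: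
  a refutation lives only where the ensemble zeroth law holds and the steady one fails for the same force.
* §G `refutation_scenario_iff_not_uniformResolution`.
-/

namespace Summit.AnomalousDissipation.AnomalousDissipation.Theorems.UniformResolution.Negative

open MeasureTheory Filter Topology
open scoped ENNReal InnerProductSpace RealInnerProductSpace
open Literature.Analysis.FunctionSpaces Literature.Analysis.FluidPDE
open Summit.AnomalousDissipation.AnomalousDissipation.Theses.MomentParity
open Summit.AnomalousDissipation.AnomalousDissipation.Theorems.QuarticGate.Negative
open Summit.AnomalousDissipation.AnomalousDissipation.Theorems

noncomputable section

/-- Local notation for the real Hilbert space `L²(T³; ℝ³)`. -/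
local notation "L2T3" => Lp (EuclideanSpace ℝ (Fin 3)) 2 (volume : Measure (UnitAddTorus (Fin 3)))

/-! ## D. Load-bearing analysis: which hypotheses of `UniformResolution` matter -/

section LoadBearing

/-- WEAKENING 1 of the antecedent (statement STRENGTHENED): `UniformResolution` with the antecedent's
stationarity required for LINEAR observables only (`d = 2`: the mean-flow row
`νAū + P_N ∫B(u,u)dμ = P_N f`) instead of every order `d`. -/
def UniformResolutionMeanRowOnly : Prop :=
  ∀ f : UnitAddTorus (Fin 3) → EuclideanSpace ℝ (Fin 3),
    Torus.IsSmooth f → Torus.IsDivFree f → Torus.HasZeroMean f →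
    ∀ (ν : ℕ → ℝ) (E ε : ℝ), (∀ j, 0 < ν j) → Tendsto ν atTop (𝓝 0) → 0 < ε →
    (∀ j : ℕ, ∃ R : ℝ, ∃ᶠ N in atTop, ∃ μ : Measure (Torus.energySpace (Fin 3)),
      IsProbabilityMeasure μ ∧ (∀ᵐ u ∂μ, IsLevel N u) ∧ (∀ᵐ u ∂μ, ‖u‖ ≤ R) ∧
      IsPolyStationary (ν j) f N 2 μ ∧ Torus.ensembleEnergy μ ≤ E ∧ ε ≤ Torus.ensembleDissipation (ν j) μ) →
    ∃ E' ε' : ℝ, 0 < ε' ∧ ∀ j : ℕ, IsResolvedLoudFamilyAt f (ν j) E' ε'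

/-- **The mean-row antecedent is witnessed at ZERO force** by the symmetric shear laws at the cutoff
frequency: `μ_{N,1}` at level `N`, viscosity `ν`, has energy `1/2`, support radius `1`, is 2-stationary
for `f = 0`, and dissipates `2π²N²ν ≥ 2π²` as soon as `N² ν ≥ 1`. [folklore] -/
theorem meanRow_antecedent_zero_force {ν : ℝ} (hν : 0 < ν) :
    ∃ R : ℝ, ∃ᶠ N in atTop, ∃ μ : Measure (Torus.energySpace (Fin 3)),
      IsProbabilityMeasure μ ∧ (∀ᵐ u ∂μ, IsLevel N u) ∧ (∀ᵐ u ∂μ, ‖u‖ ≤ R) ∧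
      IsPolyStationary ν (fun _ => 0) N 2 μ ∧ Torus.ensembleEnergy μ ≤ 1 / 2 ∧
      2 * Real.pi ^ 2 ≤ Torus.ensembleDissipation ν μ := by
  obtain ⟨M, hM⟩ := exists_nat_ge (1 / ν)
  refine ⟨1, (eventually_ge_atTop (M + 1)).frequently.mono fun N hN => ?_⟩
  have hN0 : N ≠ 0 := by omega
  refine ⟨shearLaw N hN0 1, inferInstance, ae_isLevel_shearLaw hN0 1 le_rfl,
    by simpa using ae_norm_le_shearLaw hN0 1, isPolyStationary_two_shearLaw ν hN0 1 N,
    by rw [ensembleEnergy_shearLaw]; norm_num, ?_⟩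
  rw [ensembleDissipation_shearLaw]
  have hNM : (1 / ν) ≤ (N : ℝ) := hM.trans (by exact_mod_cast (by omega : M ≤ N))
  have h1 : 1 ≤ (N : ℝ) * ν := by
    rw [div_le_iff₀ hν] at hNM; linarith
  have h1N : (1 : ℝ) ≤ N := by exact_mod_cast (show 1 ≤ N by omega)
  have h2 : 1 ≤ (N : ℝ) ^ 2 * ν := by nlinarith
  have hpi : 0 < Real.pi ^ 2 := by positivity
  nlinarith

/-- **`¬ UniformResolutionMeanRowOnly`** — the antecedent's stationarity must be used at observables of
DEGREE ≥ 2 (`d ≥ 3`): with only the mean-flow row, the symmetric shear laws `½(δ_{S_{N,1}} + δ_{S_{N,−1}})`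
at the cutoff shell (`f = 0`, `ν_j = 1/(j+1)`, `E = 1/2`, `ε = 2π²`) are loud with bounded support, while
NO resolved loud `d`-stationary family exists for `f = 0` (energy row). [folklore] -/
theorem not_uniformResolutionMeanRowOnly : ¬ UniformResolutionMeanRowOnly := fun h => by
  obtain ⟨E', ε', hε', hj⟩ := h (fun _ => 0) (Torus.isSmooth_const _)
    (CubicParityLoud.Negative.isDivFree_const 0) (by simp [Torus.HasZeroMean])
    (fun j => 1 / ((j : ℝ) + 1)) (1 / 2) (2 * Real.pi ^ 2) (fun j => by positivity)
    tendsto_one_div_add_atTop_nhds_zero_nat (by positivity)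
    (fun j => meanRow_antecedent_zero_force (by positivity))
  exact not_isResolvedLoudFamilyAt_zero_force hε' (hj 0)

/-- WEAKENING 2 of the antecedent (statement STRENGTHENED further): no stationarity at all in the
antecedent (only level, support, energy and dissipation clauses). -/
def UniformResolutionWithoutStationarity : Prop :=
  ∀ f : UnitAddTorus (Fin 3) → EuclideanSpace ℝ (Fin 3),
    Torus.IsSmooth f → Torus.IsDivFree f → Torus.HasZeroMean f →
    ∀ (ν : ℕ → ℝ) (E ε : ℝ), (∀ j, 0 < ν j) → Tendsto ν atTop (𝓝 0) → 0 < ε →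
    (∀ j : ℕ, ∃ R : ℝ, ∃ᶠ N in atTop, ∃ μ : Measure (Torus.energySpace (Fin 3)),
      IsProbabilityMeasure μ ∧ (∀ᵐ u ∂μ, IsLevel N u) ∧ (∀ᵐ u ∂μ, ‖u‖ ≤ R) ∧
      Torus.ensembleEnergy μ ≤ E ∧ ε ≤ Torus.ensembleDissipation (ν j) μ) →
    ∃ E' ε' : ℝ, 0 < ε' ∧ ∀ j : ℕ, IsResolvedLoudFamilyAt f (ν j) E' ε'

/-- **`¬ UniformResolutionWithoutStationarity`** (corollary): `UniformResolution` is not a consequence of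
its budget/level/support clauses — the implication needs the dynamics. [folklore] -/
theorem not_uniformResolutionWithoutStationarity : ¬ UniformResolutionWithoutStationarity := fun h =>
  not_uniformResolutionMeanRowOnly fun f hfs hfd hfz ν E ε hν hν0 hε hant =>
    h f hfs hfd hfz ν E ε hν hν0 hε fun j => by
      obtain ⟨R, hfreq⟩ := hant j
      refine ⟨R, hfreq.mono ?_⟩
      rintro N ⟨μ, hp, hl, hs, -, hE, hD⟩
      exact ⟨μ, hp, hl, hs, hE, hD⟩

/-- WEAKENING 3 (of the hypotheses): `UniformResolution` without `0 < ε`. -/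
def UniformResolutionWithoutEpsPos : Prop :=
  ∀ f : UnitAddTorus (Fin 3) → EuclideanSpace ℝ (Fin 3),
    Torus.IsSmooth f → Torus.IsDivFree f → Torus.HasZeroMean f →
    ∀ (ν : ℕ → ℝ) (E ε : ℝ), (∀ j, 0 < ν j) → Tendsto ν atTop (𝓝 0) →
    (∀ j : ℕ, IsLoudFamilyAt f (ν j) E ε) →
    ∃ E' ε' : ℝ, 0 < ε' ∧ ∀ j : ℕ, IsResolvedLoudFamilyAt f (ν j) E' ε'

/-- The antecedent with `ε = 0`, `E = 0` is witnessed at `f = 0` by `δ₀` (all rows vanish identically,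
at every level and every order). [folklore] -/
theorem isLoudFamilyAt_zero_force_dirac_zero {ν : ℝ} (hν : 0 ≤ ν) : IsLoudFamilyAt (fun _ => 0) ν 0 0 := by
  haveI : MeasurableSingletonClass (Torus.energySpace (Fin 3)) :=
    OpensMeasurableSpace.toMeasurableSingletonClass
  refine ⟨0, Frequently.of_forall fun N d => ⟨Measure.dirac 0, inferInstance, ?_, ?_, ?_, ?_, ?_⟩⟩
  · rw [ae_dirac_eq]
    simp only [eventually_pure]
    exact fun k _ => mFourierCoeff_coe_zero k
  · rw [ae_dirac_eq]
    simp
  · intro m g P _ _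
    refine ⟨Torus.integrable_dirac _ _, ?_⟩
    rw [integral_dirac]
    exact nsGeneratorPairing_zero_zero ν _
  · simp [Torus.ensembleEnergy, integral_dirac]
  · exact mul_nonneg hν ENNReal.toReal_nonneg

/-- **`0 < ε` is load-bearing** (`¬ UniformResolutionWithoutEpsPos`): with `ε = 0` the antecedent holds
at `f = 0` (`δ₀`), and the conclusion — which still demands `ε' > 0` — fails at `f = 0`. [folklore] -/
theorem not_uniformResolutionWithoutEpsPos : ¬ UniformResolutionWithoutEpsPos := fun h => by
  obtain ⟨E', ε', hε', hj⟩ := h (fun _ => 0) (Torus.isSmooth_const _)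
    (CubicParityLoud.Negative.isDivFree_const 0) (by simp [Torus.HasZeroMean])
    (fun j => 1 / ((j : ℝ) + 1)) 0 0 (fun j => by positivity) tendsto_one_div_add_atTop_nhds_zero_nat
    (fun j => isLoudFamilyAt_zero_force_dirac_zero (by positivity))
  exact not_isResolvedLoudFamilyAt_zero_force hε' (hj 0)

/-- WEAKENING 4 (of the hypotheses): `UniformResolution` without `∀ j, 0 < ν j`. -/
def UniformResolutionWithoutNuPos : Prop :=
  ∀ f : UnitAddTorus (Fin 3) → EuclideanSpace ℝ (Fin 3),
    Torus.IsSmooth f → Torus.IsDivFree f → Torus.HasZeroMean f →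
    ∀ (ν : ℕ → ℝ) (E ε : ℝ), Tendsto ν atTop (𝓝 0) → 0 < ε →
    (∀ j : ℕ, IsLoudFamilyAt f (ν j) E ε) →
    ∃ E' ε' : ℝ, 0 < ε' ∧ ∀ j : ℕ, IsResolvedLoudFamilyAt f (ν j) E' ε'

/-- **`∀ j, 0 < ν j` is NOT load-bearing**: it follows from the antecedent and `0 < ε`
(`IsLoudFamilyAt.nu_pos`), so the weakening is EQUIVALENT to the crux. [folklore] -/
theorem uniformResolutionWithoutNuPos_iff : UniformResolutionWithoutNuPos ↔ UniformResolution := by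
  rw [uniformResolution_iff]
  constructor
  · exact fun h f hfs hfd hfz ν E ε _ hν0 hε hant => h f hfs hfd hfz ν E ε hν0 hε hant
  · exact fun h f hfs hfd hfz ν E ε hν0 hε hant =>
      h f hfs hfd hfz ν E ε (fun j => (hant j).nu_pos hε) hν0 hε hant

end LoadBearing

/-! ## E. Fixed viscosity: resolved loud families EXIST (laminar Kolmogorov Diracs) — the content of the
crux is uniformity of `(E', ε')` in `j`, i.e. `ν_j → 0` is where it lives -/

section FixedViscosity

/-- **A level-`κ₀` Dirac is resolved by the constant schedule `κ ≡ κ₀`** (its truncation at `κ₀` has the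
same spectral enstrophy). [folklore] -/
theorem isResolved_dirac_of_isLevel {κ₀ : ℕ} {u : Torus.energySpace (Fin 3)} (hu : IsLevel κ₀ u) :
    IsResolved (fun _ => κ₀) (Measure.dirac u) :=
  -- the tree's `MomentLadder.Negative.isResolved_dirac_of_isLevel` (defeq twin vocabulary `IsResolved`)
  MomentLadder.Negative.isResolved_dirac_of_isLevel hu fun _ => le_rfl

/-- **At FIXED viscosity resolved loud families exist at every level `N ≥ 1` and every order**: the
laminar Kolmogorov Dirac `δ_{[K_a]}`, `a = (4π²ν)⁻¹`, force `K_1 = cos(2πx₁)e₀`, resolved by `κ ≡ 1`,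
support radius `a`, energy `a²/2`, dissipation `(8π²ν)⁻¹` (`QuarticGate.Negative.Laminar`). So the
conclusion of `UniformResolution` is satisfiable at each `j` separately — with `E'_j = (4π²ν_j)⁻²/2 → ∞`;
the crux's content is the `j`-UNIFORM budget pair, i.e. it lives at `ν_j → 0`. [folklore] -/
theorem isResolvedLoudFamilyAt_laminar {ν : ℝ} (hν : 0 < ν) :
    IsResolvedLoudFamilyAt (kolField 1) ν ((4 * Real.pi ^ 2 * ν)⁻¹ ^ 2 / 2) (8 * Real.pi ^ 2 * ν)⁻¹ := by
  haveI : MeasurableSingletonClass (Torus.energySpace (Fin 3)) :=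
    OpensMeasurableSpace.toMeasurableSingletonClass
  have hpi : 0 < Real.pi := Real.pi_pos
  set a : ℝ := (4 * Real.pi ^ 2 * ν)⁻¹ with ha
  have ha0 : 0 < a := by positivity
  have hforce : kolField 1 = kolField (4 * Real.pi ^ 2 * ν * a) := by
    rw [ha, mul_inv_cancel₀ (by positivity)]
  refine ⟨a, fun _ => 1, (eventually_ge_atTop 1).frequently.mono fun N hN d => ?_⟩
  obtain ⟨⟨hprob, hlev, -, -, hE, hε⟩, -⟩ := isQuarticWitness_dirac_kolState hν hN
  refine ⟨Measure.dirac (kolState a), hprob, hlev, ?_, isResolved_dirac_of_isLevel (isLevel_kolState a le_rfl),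
    ?_, hE, hε⟩
  · rw [ae_dirac_eq]
    simp only [eventually_pure]
    refine (sq_le_sq₀ (norm_nonneg _) ha0.le).1 ?_
    rw [norm_sq_kolState]
    nlinarith [sq_nonneg a]
  · rw [hforce]
    exact isPolyStationary_dirac_kolState ν a N d

/-- WEAKENING 5 (of the hypotheses): `UniformResolution` without `ν_j → 0`. NOT refuted: at constant
viscosity the laminar instance satisfies antecedent AND conclusion (next theorem); a refutation of this
weakening would again need a non-laminar loud family. Recorded as the statement only. -/
def UniformResolutionWithoutVanishingViscosity : Prop :=
  ∀ f : UnitAddTorus (Fin 3) → EuclideanSpace ℝ (Fin 3),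
    Torus.IsSmooth f → Torus.IsDivFree f → Torus.HasZeroMean f →
    ∀ (ν : ℕ → ℝ) (E ε : ℝ), (∀ j, 0 < ν j) → 0 < ε →
    (∀ j : ℕ, IsLoudFamilyAt f (ν j) E ε) →
    ∃ E' ε' : ℝ, 0 < ε' ∧ ∀ j : ℕ, IsResolvedLoudFamilyAt f (ν j) E' ε'

/-- The laminar instance of the weakening: constant viscosity `ν₀`, force `K_1`, antecedent and conclusion
both hold with the same budgets. [folklore] -/
theorem laminar_instance_constant_viscosity {ν₀ : ℝ} (hν : 0 < ν₀) :
    (∀ _j : ℕ, IsLoudFamilyAt (kolField 1) ν₀ ((4 * Real.pi ^ 2 * ν₀)⁻¹ ^ 2 / 2) (8 * Real.pi ^ 2 * ν₀)⁻¹) ∧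
    ∃ E' ε' : ℝ, 0 < ε' ∧ ∀ _j : ℕ, IsResolvedLoudFamilyAt (kolField 1) ν₀ E' ε' :=
  ⟨fun _ => (isResolvedLoudFamilyAt_laminar hν).isLoudFamilyAt, _, _,
    by have := Real.pi_pos; positivity, fun _ => isResolvedLoudFamilyAt_laminar hν⟩

end FixedViscosity

/-! ## H. How a PROOF would go: the resolution criterion applied to the conclusion body -/

section Criterion

/-- **Sufficient condition for the conclusion of the crux at one viscosity** (`Negative/ResolutionCriterion.lean`):
laws `μ ∈ 𝓕` — level-`N` for infinitely many `N`, supported in one ball, stationary at EVERY order (e.g. the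
Galerkin-invariant laws produced by MomentClosure), loud with budgets `(E, ε)` — whose family has uniformly
integrable enstrophy and a uniform weighted `H²` bound (some exponent `p`), give `IsResolvedLoudFamilyAt f ν E ε`.
The weighted bound is the Foias–Guillopé–Temam estimate (N-uniform for invariant level-`N` laws by the Agmon
bootstrap of `Negative/SteadyResolved.lean`); the uniform integrability is the open part. [folklore] -/
theorem isResolvedLoudFamilyAt_of_criterion {f : UnitAddTorus (Fin 3) → EuclideanSpace ℝ (Fin 3)}
    {ν E ε R : ℝ} {𝓕 : Set (Measure (Torus.energySpace (Fin 3)))} {p : ℕ}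
    (hUI : UniformlyIntegrableEnstrophy 𝓕) (hH2 : WeightedH2Bound p 𝓕)
    (h : ∃ᶠ N in atTop, ∃ μ ∈ 𝓕, IsProbabilityMeasure μ ∧ (∀ᵐ u ∂μ, IsLevel N u) ∧ (∀ᵐ u ∂μ, ‖u‖ ≤ R) ∧
      (∀ d, IsPolyStationary ν f N d μ) ∧ Torus.ensembleEnergy μ ≤ E ∧ ε ≤ Torus.ensembleDissipation ν μ) :
    IsResolvedLoudFamilyAt f ν E ε := by
  obtain ⟨κ, hκ⟩ := exists_isResolved_of_uniformlyIntegrable_of_weightedH2 hUI hH2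
  refine ⟨R, κ, h.mono ?_⟩
  rintro N ⟨μ, hμ, hp, hl, hs, hst, hE, hD⟩ d
  exact ⟨μ, hp, hl, hs, hκ μ hμ, hst d, hE, hD⟩

/-- **WHERE THE CRUX EXACTLY LIVES** (`Negative/FGTBound.lean` + `Negative/ResolutionCriterion.lean`): at
viscosity `ν > 0` with a smooth force, a family of FGT-stationary laws (e.g. the Galerkin-INVARIANT loud laws of
MomentClosure, level by level) that are level-`N` for infinitely many `N`, supported in one ball, stationary at
every order and loud with budgets `(E, ε)` gives the conclusion body `IsResolvedLoudFamilyAt f ν E ε` AS SOON AS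
the family has UNIFORMLY INTEGRABLE ENSTROPHY. Hence `UniformResolution ⇐ MomentClosure ∧ (∀ j, uniform
integrability of the enstrophy over a loud invariant family at ν_j)`; and a refutation must force NON-uniformly-
integrable (intermittent) enstrophy on every loud invariant family of its force at some `ν_j`. [folklore] -/
theorem isResolvedLoudFamilyAt_of_fgt_of_uniformlyIntegrable {f : UnitAddTorus (Fin 3) → EuclideanSpace ℝ (Fin 3)}
    (hf : Torus.IsSmooth f) {ν E ε R : ℝ} (hν : 0 < ν) {𝓕 : Set (Measure (Torus.energySpace (Fin 3)))}
    (h𝓕 : ∀ μ ∈ 𝓕, ∃ N, IsFGTStationary ν f N μ) (hUI : UniformlyIntegrableEnstrophy 𝓕)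
    (h : ∃ᶠ N in atTop, ∃ μ ∈ 𝓕, IsProbabilityMeasure μ ∧ (∀ᵐ u ∂μ, IsLevel N u) ∧ (∀ᵐ u ∂μ, ‖u‖ ≤ R) ∧
      (∀ d, IsPolyStationary ν f N d μ) ∧ Torus.ensembleEnergy μ ≤ E ∧ ε ≤ Torus.ensembleDissipation ν μ) :
    IsResolvedLoudFamilyAt f ν E ε :=
  isResolvedLoudFamilyAt_of_criterion hUI (weightedH2Bound_four_of_fgt hν hf h𝓕) h

end Criterion

/-! ## F. Why it resists — the STEADY sector is resolved (unconditionally, `Negative/SteadyResolved.lean`), so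
`¬ UniformResolution` lives in "ensemble-loud but steady-quiet, universally leaking" worlds -/

section Steady

/-- The Dirac mass at a Galerkin steady state (`IsGalerkinSteady` of `Negative/SteadyStates.lean`: every
level-`N` band test annihilates the generator row) is `d`-stationary at every order, for a smooth force
(rows of polynomial tests are finite combinations of band-test rows). [folklore] -/
theorem isPolyStationary_dirac_of_isGalerkinSteady {ν : ℝ} {f : UnitAddTorus (Fin 3) → EuclideanSpace ℝ (Fin 3)}
    (hf : Torus.IsSmooth f) {N : ℕ} {u : Torus.energySpace (Fin 3)} (hu : IsGalerkinSteady ν f N u) (d : ℕ) :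
    IsPolyStationary ν f N d (Measure.dirac u) := by
  haveI : MeasurableSingletonClass (Torus.energySpace (Fin 3)) :=
    OpensMeasurableSpace.toMeasurableSingletonClass
  intro m g P hg _
  refine ⟨Torus.integrable_dirac _ _, ?_⟩
  rw [integral_dirac]
  exact hu.row_polyGrad hf g P hg

/-- LOUD STEADY FAMILY at one viscosity: bounded-energy Galerkin steady states with dissipation `≥ ε`,
in a common ball, at infinitely many levels (the body of a Galerkin STEADY zeroth law, cf. route
MirrorVariety's `GalerkinSteadyZerothLaw`). -/
def IsLoudSteadyFamilyAt (f : UnitAddTorus (Fin 3) → EuclideanSpace ℝ (Fin 3)) (ν E ε : ℝ) : Prop :=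
  ∃ R : ℝ, ∃ᶠ N in atTop, ∃ u : Torus.energySpace (Fin 3), IsLevel N u ∧ ‖u‖ ≤ R ∧
    IsGalerkinSteady ν f N u ∧ ‖u‖ ^ 2 ≤ E ∧
    ε ≤ ν * (Torus.eGradNormSq ((u.1 : L2T3) : UnitAddTorus (Fin 3) → EuclideanSpace ℝ (Fin 3))).toReal

/-- **STEADY DIRACS ARE RESOLVED, UNIFORMLY IN THE LEVEL** (restated with `IsResolved`; the `N`-uniform
`H²` bound for Galerkin steady states of `Negative/SteadyResolved.lean`): for smooth `f`, `ν > 0` and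
every radius `R` ONE schedule `κ` resolves the Dirac mass at every level-`N` Galerkin steady state in the
`R`-ball, for every `N`. [folklore] -/
theorem steadyDiracsResolved {f : UnitAddTorus (Fin 3) → EuclideanSpace ℝ (Fin 3)} (hf : Torus.IsSmooth f)
    {ν : ℝ} (hν : 0 < ν) (R : ℝ) :
    ∃ κ : ℕ → ℕ, ∀ (N : ℕ) (u : Torus.energySpace (Fin 3)),
      IsLevel N u → ‖u‖ ≤ R → IsGalerkinSteady ν f N u → IsResolved κ (Measure.dirac u) :=
  exists_schedule_steady_resolved hν hf R

/-- **The steady sector satisfies the conclusion, unconditionally**: a loud STEADY family at viscosity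
`ν > 0` (smooth force) IS a RESOLVED loud `d`-stationary family with the same budgets. Hence if the
antecedent of `UniformResolution` is ever witnessed by Diracs at Galerkin steady states (a Galerkin steady
zeroth law along `ν_j`), the conclusion holds for that `(f, ν)` — a refutation must come from genuinely
statistical (non-Dirac) loud families for a force WITHOUT loud bounded-energy steady states, all of whose
loud invariant laws leak enstrophy to the cutoff `N`-frequently at some fixed `ν_j`. [folklore] -/
theorem isResolvedLoudFamilyAt_of_steady {f : UnitAddTorus (Fin 3) → EuclideanSpace ℝ (Fin 3)}
    (hf : Torus.IsSmooth f) {ν E ε : ℝ} (hν : 0 < ν) (h : IsLoudSteadyFamilyAt f ν E ε) :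
    IsResolvedLoudFamilyAt f ν E ε := by
  haveI : MeasurableSingletonClass (Torus.energySpace (Fin 3)) :=
    OpensMeasurableSpace.toMeasurableSingletonClass
  obtain ⟨R, hfreq⟩ := h
  obtain ⟨κ, hκ⟩ := steadyDiracsResolved hf hν R
  refine ⟨R, κ, hfreq.mono ?_⟩
  rintro N ⟨u, hlev, hR, hst, hE, hε⟩ d
  refine ⟨Measure.dirac u, inferInstance, ?_, ?_, hκ N u hlev hR hst,
    isPolyStationary_dirac_of_isGalerkinSteady hf hst d, ?_, ?_⟩
  · rw [ae_dirac_eq]; simpa using hlev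
  · rw [ae_dirac_eq]; simpa using hR
  · rw [Torus.ensembleEnergy, integral_dirac]; exact hE
  · unfold Torus.ensembleDissipation Torus.ensembleEnstrophy
    rw [lintegral_dirac]; exact hε

/-- Consequently `¬ UniformResolution` forces, for its witnessing force and viscosities, the FAILURE of the
steady zeroth law with the witnessing budgets at some `j`: no loud steady family with budgets `(E', ε')`
for every budget pair — in particular not with the antecedent's own `(E, ε)`. [folklore] -/
theorem not_isLoudSteadyFamilyAt_of_not_uniformResolution (h : ¬ UniformResolution) :
    ∃ f : UnitAddTorus (Fin 3) → EuclideanSpace ℝ (Fin 3),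
      Torus.IsSmooth f ∧ Torus.IsDivFree f ∧ Torus.HasZeroMean f ∧
      ∃ (ν : ℕ → ℝ) (E ε : ℝ), (∀ j, 0 < ν j) ∧ Tendsto ν atTop (𝓝 0) ∧ 0 < ε ∧
      (∀ j : ℕ, IsLoudFamilyAt f (ν j) E ε) ∧
      ∀ E' ε' : ℝ, 0 < ε' → ∃ j : ℕ, ¬ IsLoudSteadyFamilyAt f (ν j) E' ε' := by
  obtain ⟨f, hfs, hfd, hfz, ν, E, ε, hν, hν0, hε, hloud, hno⟩ := not_uniformResolution_iff.1 h
  refine ⟨f, hfs, hfd, hfz, ν, E, ε, hν, hν0, hε, hloud, fun E' ε' hε' => ?_⟩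
  obtain ⟨j, hj⟩ := hno E' ε' hε'
  exact ⟨j, fun hs => hj (isResolvedLoudFamilyAt_of_steady hfs (hν j) hs)⟩

end Steady

/-! ## G. The refutation scenario, restated (nothing remains sorried) -/

section Scenario

/-- THE ONLY REFUTATION SCENARIO, as a statement: a force with a `d`-wise Galerkin-ensemble zeroth law whose
every resolved loud family fails at some viscosity — by §A this is literally `¬ UniformResolution`; by §F the
force has NO loud bounded-energy Galerkin steady states along `ν_j` for any budgets
(`not_isLoudSteadyFamilyAt_of_not_uniformResolution`); by §H every loud invariant family of it has
non-uniformly-integrable enstrophy at some `ν_j` (granted the FGT weighted bound). Physically: statistics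
thermalising at the truncation scale at FIXED ν (truncated-Euler-like bottleneck) FORCED on every loud ensemble —
failure of the mean energy EQUALITY for every loud Galerkin-limit stationary statistical solution of that force.
No construction of either half is within reach (the first half alone is the zeroth law). [folklore] -/
theorem refutation_scenario_iff_not_uniformResolution :
    (∃ f : UnitAddTorus (Fin 3) → EuclideanSpace ℝ (Fin 3),
      Torus.IsSmooth f ∧ Torus.IsDivFree f ∧ Torus.HasZeroMean f ∧
      ∃ (ν : ℕ → ℝ) (E ε : ℝ), (∀ j, 0 < ν j) ∧ Tendsto ν atTop (𝓝 0) ∧ 0 < ε ∧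
      (∀ j : ℕ, IsLoudFamilyAt f (ν j) E ε) ∧
      ∀ E' ε' : ℝ, 0 < ε' → ∃ j : ℕ, ¬ IsResolvedLoudFamilyAt f (ν j) E' ε') ↔ ¬ UniformResolution :=
  not_uniformResolution_iff.symm

end Scenario

end

end Summit.AnomalousDissipation.AnomalousDissipation.Theorems.UniformResolution.Negative
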